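/-
COR-CM (cell pub-hodgecm2, stage 2 of the Hodge ladder) — count-neutral KERNEL COMBINATORICS «β − 1 − δ faces for every Galois CM field containing
an imaginary quadratic field» (seat prover-pub-hodgecm2-b23-g40-0, binder prover b23, gen 40; claim COMPLEMENT-FACES F6, HOME/INBOX.md l.9766).
Theorems only; no geometry beyond the tree's `Face` / `faceOfG`, no `Universe` field touched, no named fact, nothing asserted; seat b09's floors
(`CorCM/FaceCoinvariantFloor.lean`, `CorCM/FaceCoinvariantComplement.lean`, `CorCM/FaceCoinvariantOddHalf.lean`), the INT2-GEN socket
(`CorCM/FacePeriodsGeneratingSet.lean`) and the seat's `Census/ComplementFaces*` (parts I–V) are used BY NAME; `Interfaces.lean` (C1), every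
E term, B01 and `Transposition/*` are untouched.
HONEST FRAMING (COORDINATOR RULING — HODGE FRAMING CORRECTION, 2026-08-21T11:55:35Z): `HC_CM` is NOT proved, here or anywhere in the tree;
this file produces no period and proves no face period for any field; its one `HodgeConjectureFor` statement is CONDITIONAL on face periods.
T5: n/a-class — the only Prop hypothesis binders displayed are the complement / index-two / imaginary-quadratic-subfield data and INT2-GEN's
period hypothesis on the produced face set (§4); no named-fact / conjecture-def binder; checker: self (prover-pub-hodgecm2-b23-g40-0), 2026-08-23.
-/
import Summits.HodgeConjecture.CorCM.Census.ComplementFacesGenerate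
import Summits.HodgeConjecture.CorCM.FaceCyclicGeneration
import Summits.HodgeConjecture.CorCM.FaceCoinvariantComplement
import Summits.HodgeConjecture.CorCM.FaceCoinvariantOddHalf
import Summits.HodgeConjecture.CorCM.FaceAbelianImaginaryQuadratic
import Summits.HodgeConjecture.CorCM.FaceCensusOddSliceTransport
import HarnessLib

/-!
# Galois CM fields containing an imaginary quadratic field: EXACTLY `β − 1 − δ` generating rank-four faces — any Galois group

Let `F` be a Galois CM field whose complex conjugation `conjT` is COMPLEMENTED among the Galois translates: a subgroup `A ≤ GalT F` with
`P ∈ A ↔ conjT·P ∉ A` — equivalently a subgroup of index two missing `conjT` (§3), equivalently (§2, `exists_cpl_of_imaginary_quadratic_subfield`,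
NO commutativity) `F` contains an IMAGINARY QUADRATIC field `E` (`F = E·F⁺`, `Gal(F/ℚ) = Gal(F/E) × ⟨conj⟩` with `Gal(F/E) ≅ Gal(F⁺/ℚ)` an
ARBITRARY finite group: `S₃`, `D₄`, `Q₈`, `A₄`, `ℤ/7 ⋊ ℤ/3`, …; the unitary ∕ Picard-modular situation `F ⊇ E` of COR-CM).  Write `2n = [F:ℚ]`,
`β(F) = #Block conjT` (↔ the simple CM isogeny classes split by `F`, [Milne1999, Prop. 2.1]) and `δ(F) = wdelta conjT T₀ ∈ {0, 1}`
(`= [n even]`, seat b09).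

* §1 **`exists_faces_hgen_of_cpl`** / **`isLeast_card_faces_hgen_of_cpl`**: for every base embedding `σ₀` there is a finite set `𝒮` of rank-four
  faces of `F` with **`|𝒮| + 1 + δ(F) = β(F)`** satisfying INT2-GEN's generation binder `hgen(𝒮, σ₀)`, and NO SMALLER face set does: the least size
  is EXACTLY `β(F) − 1 − δ(F) = φ₂(F)` (seat b09's face-coinvariant floor `FaceCoinvariant.fibreTwo_le_card_of_hgen` +
  `…fibreTwo_add_one_add_wdelta_eq_card_block_of_cpl`) — **`β(F) − 1` for `n` odd, `β(F) − 2` for `n` even**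
  (`isLeast_card_faces_hgen_of_cpl_odd/even`).  This is the field form of the seat's `Census.ComplementFaces.exists_gfaces_generate_of_cpl_card_eq`
  (parts I–V: the canonical squares, the class descent, the Weil vector and the two closing arguments — parity-uniform and COMMUTATIVITY-FREE),
  read through `faceOfG` (`FaceCyclic.exists_faces_reading`, `FaceCyclic.span_translates_le_reads`) and `hgen_of_weightRel_mem_span`.
  It supersedes, hypothesis for hypothesis, the abelian statements of `CorCM/FaceAbelianMain.lean` (which display `Aut(F)` commutative).
* §2 the dictionary «imaginary quadratic subfield ⟹ complement» (`galTOfAut`, `index_fixingSubgroup_eq_two`; no commutativity) and the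
  presentation-free corollaries; §3 the index-two form.
* §4 **`hodgeConjectureFor_of_imaginary_quadratic_subfield_of_exists_facePeriod'`** (INT2-GEN socket BY NAME): a face set of that least size EXISTS
  whose periods on the universe of record give the Hodge conjecture for every abelian variety dominated by a product of CM abelian varieties with
  CM by subfields of `F` — CONDITIONAL on those periods; `HC_CM` is NOT proved.

References: [cite: Pohlmann1968, Thm. 1]; [cite: Milne1999LefschetzClasses, Thm. 3.2, Prop. 2.1]; [cite: Shimura1998, §6.2 Theorem 3 and §6.1
Corollary of Theorem 2 (pp. 41–43), §8.1 (p. 62)]; [cite: MumfordAV1970, §19 Thm. 1 and p. 169].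
-/

noncomputable section

open CategoryTheory NumberField NumberField.ComplexEmbedding
open Literature.AlgebraicGeometry Literature.AlgebraicGeometry.Motives Literature.AlgebraicGeometry.HodgeTheory
open Literature.AlgebraicGeometry.ComplexMultiplication Literature.AlgebraicGeometry.Milne1999
open Literature.NumberTheory.Automorphic
open Literature.NumberTheory.Automorphic.PicardCM
open Summit.HodgeConjecture.CorCM.Domination

namespace Summit.HodgeConjecture.CorCM.FaceComplement

open Summit.HodgeConjecture.CorCM.Prior.AllgGroup.RfwfAllgGroup
open Summit.HodgeConjecture.CorCM.Census.BlockParity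
open Summit.HodgeConjecture.CorCM.Census.Coinvariant
open Summit.HodgeConjecture.CorCM.FaceCensus.OddSlice (galTOfAut galTOfAut_mul galTOfAut_conjAut)

/-! ## §1 Complemented conjugation: `β(F) − 1 − δ(F)` generating faces, none fewer -/

section Field

variable {F : Type} [Field F] [NumberField F]

/-- **EVERY GALOIS CM FIELD WITH COMPLEMENTED CONJUGATION HAS `β − 1 − δ` GENERATING FACES.**  For `F` Galois CM, a complement `A` of `conjT`
in `GalT F` (any finite group), any base type `T₀` and base embedding `σ₀`: a finite set `𝒮` of rank-four faces with
`|𝒮| + 1 + δ(F) = β(F) = #Block conjT` and `hgen(𝒮, σ₀)`. [folklore] -/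
theorem exists_faces_hgen_of_cpl [IsCMField F] [IsGalois ℚ F] {A : Subgroup (GalT F)} (hA : ∀ P : GalT F, P ∈ A ↔ conjT * P ∉ A)
    (T₀ : CMF (GalT F) conjT) (σ₀ : F →+* ℂ) :
    ∃ 𝒮 : Finset (Face F), 𝒮.card + 1 + wdelta (conjT : GalT F) T₀ = Fintype.card (Block (conjT : GalT F)) ∧
      ∀ f : Face F, lefChar f.corner (fun _ => ({σ₀} : Finset (F →+* ℂ))) ∈ AddSubgroup.closure
        {a : Asym F | ∃ g ∈ (𝒮 : Set (Face F)), ∃ σ : F →+* ℂ, a = lefChar g.corner (fun _ => ({σ} : Finset (F →+* ℂ)))} := by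
  obtain ⟨S, hS, hcard, -, hgenr⟩ := Census.ComplementFaces.exists_gfaces_generate_of_cpl_card_eq (conjT : GalT F) hA conjT_mul_self
    conjT_ne_one (fun P => FaceBasis.conjT_comm P) T₀
  obtain ⟨𝒮, h𝒮card, hread⟩ := FaceCyclic.exists_faces_reading σ₀ S hS
  have hle := FaceCyclic.span_translates_le_reads σ₀ S (𝒮 : Set (Face F))
    (fun s hs => by obtain ⟨g, hg, h⟩ := hread s hs; exact ⟨g, Finset.mem_coe.mpr hg, h⟩)
  have hgen : ∀ f : Face F, lefChar f.corner (fun _ => ({σ₀} : Finset (F →+* ℂ))) ∈ AddSubgroup.closure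
      {a : Asym F | ∃ g ∈ (𝒮 : Set (Face F)), ∃ σ : F →+* ℂ, a = lefChar g.corner (fun _ => ({σ} : Finset (F →+* ℂ)))} :=
    hgen_of_weightRel_mem_span (𝒮 : Set (Face F)) σ₀ fun f => hle (hgenr (FaceCoinvariant.weightRel_corner_mem_hodgeSpan f σ₀))
  refine ⟨𝒮, le_antisymm (by omega) ?_, hgen⟩
  have h1 := FaceCoinvariant.fibreTwo_le_card_of_hgen 𝒮 σ₀ hgen
  have h2 := FaceCoinvariant.fibreTwo_add_one_add_wdelta_eq_card_block_of_cpl hA T₀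
  omega

/-- **… AND NONE SMALLER**: the least size of a face set `𝒮` with `hgen(𝒮, σ₀)` is EXACTLY `β(F) − 1 − δ(F)` (`= φ₂(F)`), for every Galois CM field
with complemented conjugation, every base type and every base embedding. [folklore] -/
theorem isLeast_card_faces_hgen_of_cpl [IsCMField F] [IsGalois ℚ F] {A : Subgroup (GalT F)} (hA : ∀ P : GalT F, P ∈ A ↔ conjT * P ∉ A)
    (T₀ : CMF (GalT F) conjT) (σ₀ : F →+* ℂ) :
    IsLeast {m : ℕ | ∃ 𝒮 : Finset (Face F), 𝒮.card = m ∧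
      ∀ f : Face F, lefChar f.corner (fun _ => ({σ₀} : Finset (F →+* ℂ))) ∈ AddSubgroup.closure
        {a : Asym F | ∃ g ∈ (𝒮 : Set (Face F)), ∃ σ : F →+* ℂ, a = lefChar g.corner (fun _ => ({σ} : Finset (F →+* ℂ)))}}
      (Fintype.card (Block (conjT : GalT F)) - 1 - wdelta (conjT : GalT F) T₀) := by
  have hβ := FaceCoinvariant.fibreTwo_add_one_add_wdelta_eq_card_block_of_cpl hA T₀
  constructor
  · obtain ⟨𝒮, hcard, hgen⟩ := exists_faces_hgen_of_cpl hA T₀ σ₀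
    exact ⟨𝒮, by omega, hgen⟩
  · rintro m ⟨𝒮, rfl, hgen⟩
    have h1 := FaceCoinvariant.fibreTwo_le_card_of_hgen 𝒮 σ₀ hgen
    omega

/-- **Half-degree ODD, conjugation complemented: EXACTLY `β(F) − 1` generating faces.** [folklore] -/
theorem isLeast_card_faces_hgen_of_cpl_odd [IsCMField F] [IsGalois ℚ F] {A : Subgroup (GalT F)} (hA : ∀ P : GalT F, P ∈ A ↔ conjT * P ∉ A)
    (hodd : Odd (Module.finrank ℚ F / 2)) (σ₀ : F →+* ℂ) :
    IsLeast {m : ℕ | ∃ 𝒮 : Finset (Face F), 𝒮.card = m ∧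
      ∀ f : Face F, lefChar f.corner (fun _ => ({σ₀} : Finset (F →+* ℂ))) ∈ AddSubgroup.closure
        {a : Asym F | ∃ g ∈ (𝒮 : Set (Face F)), ∃ σ : F →+* ℂ, a = lefChar g.corner (fun _ => ({σ} : Finset (F →+* ℂ)))}}
      (Fintype.card (Block (conjT : GalT F)) - 1) := by
  have h := isLeast_card_faces_hgen_of_cpl hA (cplT conjT A hA) σ₀
  have h1 := FaceCoinvariant.fibreTwo_add_one_add_wdelta_eq_card_block_of_cpl hA (cplT conjT A hA)
  have h2 := FaceCoinvariant.fibreTwo_add_one_eq_card_block_of_odd_finrank_div_two (F := F) hodd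
  rwa [show wdelta (conjT : GalT F) (cplT conjT A hA) = 0 by omega, Nat.sub_zero] at h

/-- **Half-degree EVEN, conjugation complemented: EXACTLY `β(F) − 2` generating faces.** [folklore] -/
theorem isLeast_card_faces_hgen_of_cpl_even [IsCMField F] [IsGalois ℚ F] {A : Subgroup (GalT F)} (hA : ∀ P : GalT F, P ∈ A ↔ conjT * P ∉ A)
    (heven : Even (Module.finrank ℚ F / 2)) (σ₀ : F →+* ℂ) :
    IsLeast {m : ℕ | ∃ 𝒮 : Finset (Face F), 𝒮.card = m ∧
      ∀ f : Face F, lefChar f.corner (fun _ => ({σ₀} : Finset (F →+* ℂ))) ∈ AddSubgroup.closure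
        {a : Asym F | ∃ g ∈ (𝒮 : Set (Face F)), ∃ σ : F →+* ℂ, a = lefChar g.corner (fun _ => ({σ} : Finset (F →+* ℂ)))}}
      (Fintype.card (Block (conjT : GalT F)) - 2) := by
  have h := isLeast_card_faces_hgen_of_cpl hA (cplT conjT A hA) σ₀
  rwa [FaceCoinvariant.wdelta_eq_one_of_cpl hA heven (cplT conjT A hA)] at h

/-! ## §2 From an imaginary quadratic subfield (no commutativity) -/

/-- **An imaginary quadratic subfield complements complex conjugation** (`F/ℚ` Galois, no commutativity): `E ⊆ F` of degree `2` with an element of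
non-real image under `σ₀` ⟹ the Galois translates fixing `E` (read through `galTOfAut σ₀`) form a complement of `conjT`.
[cite: Shimura1998, §8.1 (p. 62)] -/
theorem exists_cpl_of_imaginary_quadratic_subfield [IsCMField F] [IsGalois ℚ F] (σ₀ : F →+* ℂ) (E : IntermediateField ℚ F)
    (hE : Module.finrank ℚ E = 2) (hx : ∃ x ∈ E, (σ₀ x).im ≠ 0) :
    ∃ A : Subgroup (GalT F), ∀ P : GalT F, P ∈ A ↔ conjT * P ∉ A := by
  obtain ⟨c, hc⟩ := FaceCensus.exists_conjAut σ₀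
  set e : (F ≃ₐ[ℚ] F) ≃* GalT F := MulEquiv.mk' (galTOfAut σ₀) (galTOfAut_mul σ₀) with he
  have hec : e c = conjT := by rw [he]; exact galTOfAut_conjAut σ₀ hc
  refine ⟨E.fixingSubgroup.map (e : (F ≃ₐ[ℚ] F) →* GalT F), FaceCoinvariant.cpl_of_index_two ?_ ?_⟩
  · rw [Subgroup.index_map_equiv, FaceAbelian.index_fixingSubgroup_eq_two E hE]
  · intro hmem
    rw [← hec] at hmem
    obtain ⟨g, hg, hge⟩ := Subgroup.mem_map.mp hmem
    have hgc : g = c := e.injective hge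
    rw [hgc] at hg
    obtain ⟨x, hxE, hxim⟩ := hx
    have hfix : c x = x := (IntermediateField.mem_fixingSubgroup_iff E c).mp hg x hxE
    have h1 : σ₀ (c x) = starRingEnd ℂ (σ₀ x) := by
      have := RingHom.congr_fun hc x
      simpa [conjugate_coe_eq] using this
    rw [hfix] at h1
    have h2 := congrArg Complex.im h1
    rw [Complex.conj_im] at h2
    exact hxim (by linarith)

/-- **GALOIS CM FIELD ⊇ IMAGINARY QUADRATIC, HALF-DEGREE ODD: EXACTLY `β(F) − 1` GENERATING FACES** — `Gal(F⁺/ℚ)` arbitrary. [folklore] -/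
theorem isLeast_card_faces_hgen_of_imaginary_quadratic_subfield_odd [IsCMField F] [IsGalois ℚ F] (σ₀ : F →+* ℂ)
    (E : IntermediateField ℚ F) (hE : Module.finrank ℚ E = 2) (hx : ∃ x ∈ E, (σ₀ x).im ≠ 0) (hodd : Odd (Module.finrank ℚ F / 2)) :
    IsLeast {m : ℕ | ∃ 𝒮 : Finset (Face F), 𝒮.card = m ∧
      ∀ f : Face F, lefChar f.corner (fun _ => ({σ₀} : Finset (F →+* ℂ))) ∈ AddSubgroup.closure
        {a : Asym F | ∃ g ∈ (𝒮 : Set (Face F)), ∃ σ : F →+* ℂ, a = lefChar g.corner (fun _ => ({σ} : Finset (F →+* ℂ)))}}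
      (Fintype.card (Block (conjT : GalT F)) - 1) := by
  obtain ⟨A, hA⟩ := exists_cpl_of_imaginary_quadratic_subfield σ₀ E hE hx
  exact isLeast_card_faces_hgen_of_cpl_odd hA hodd σ₀

/-- **GALOIS CM FIELD ⊇ IMAGINARY QUADRATIC, HALF-DEGREE EVEN: EXACTLY `β(F) − 2` GENERATING FACES** — `Gal(F⁺/ℚ)` arbitrary. [folklore] -/
theorem isLeast_card_faces_hgen_of_imaginary_quadratic_subfield_even [IsCMField F] [IsGalois ℚ F] (σ₀ : F →+* ℂ)
    (E : IntermediateField ℚ F) (hE : Module.finrank ℚ E = 2) (hx : ∃ x ∈ E, (σ₀ x).im ≠ 0) (heven : Even (Module.finrank ℚ F / 2)) :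
    IsLeast {m : ℕ | ∃ 𝒮 : Finset (Face F), 𝒮.card = m ∧
      ∀ f : Face F, lefChar f.corner (fun _ => ({σ₀} : Finset (F →+* ℂ))) ∈ AddSubgroup.closure
        {a : Asym F | ∃ g ∈ (𝒮 : Set (Face F)), ∃ σ : F →+* ℂ, a = lefChar g.corner (fun _ => ({σ} : Finset (F →+* ℂ)))}}
      (Fintype.card (Block (conjT : GalT F)) - 2) := by
  obtain ⟨A, hA⟩ := exists_cpl_of_imaginary_quadratic_subfield σ₀ E hE hx
  exact isLeast_card_faces_hgen_of_cpl_even hA heven σ₀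

/-! ## §3 By index -/

/-- **Index-two form**: a subgroup of index two of `GalT F` missing `conjT` ⟹ exactly `β(F) − 1 − δ(F)` generating faces. [folklore] -/
theorem isLeast_card_faces_hgen_of_index_two [IsCMField F] [IsGalois ℚ F] {A : Subgroup (GalT F)} (h2 : A.index = 2) (hc : conjT ∉ A)
    (T₀ : CMF (GalT F) conjT) (σ₀ : F →+* ℂ) :
    IsLeast {m : ℕ | ∃ 𝒮 : Finset (Face F), 𝒮.card = m ∧
      ∀ f : Face F, lefChar f.corner (fun _ => ({σ₀} : Finset (F →+* ℂ))) ∈ AddSubgroup.closure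
        {a : Asym F | ∃ g ∈ (𝒮 : Set (Face F)), ∃ σ : F →+* ℂ, a = lefChar g.corner (fun _ => ({σ} : Finset (F →+* ℂ)))}}
      (Fintype.card (Block (conjT : GalT F)) - 1 - wdelta (conjT : GalT F) T₀) :=
  isLeast_card_faces_hgen_of_cpl (FaceCoinvariant.cpl_of_index_two h2 hc) T₀ σ₀

end Field

/-! ## §4 The Hodge-conjecture reading through the INT2-GEN socket (conditional on the face periods) -/

/-- **HC for the slice of a Galois CM field containing an imaginary quadratic field, from `β − 1 − δ` face periods** (INT2-GEN socket BY NAME;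
CONDITIONAL on the periods — `HC_CM` is NOT proved; `Gal(K⁺/ℚ)` ARBITRARY, no commutativity): for `K` Galois CM of degree `≥ 6` with a quadratic
subfield `E` having a non-real element under `σ₀`, there is a face set `𝒮` with `|𝒮| = β(K) − 1` (half-degree odd) / `β(K) − 2` (half-degree even)
such that ONE period witness per face of `𝒮` on the universe of record implies the Hodge conjecture for every abelian variety dominated by a product
of CM abelian varieties with CM by subfields of `K`.
[cite: Shimura1998, §6.2 Theorem 3 and §6.1 Corollary of Theorem 2 (pp. 41–43)] [cite: Pohlmann1968, Thm. 1]
[cite: Milne1999LefschetzClasses, Thm. 3.2 and Cor. 4.5] [cite: MumfordAV1970, §19 Thm. 1 and p. 169] -/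
theorem hodgeConjectureFor_of_imaginary_quadratic_subfield_of_exists_facePeriod' (K : CMField) [hGal : IsGalois ℚ K]
    (σ₀ : (K : Type) →+* ℂ) (E : IntermediateField ℚ (K : Type)) (hE : Module.finrank ℚ E = 2) (hx : ∃ x ∈ E, (σ₀ x).im ≠ 0)
    (h6 : 6 ≤ Module.finrank ℚ K) :
    ∃ 𝒮 : Finset (Face K),
      𝒮.card = Fintype.card (Block (conjT : GalT K)) - (if Even (Module.finrank ℚ K / 2) then 2 else 1) ∧
      ((∀ f ∈ 𝒮, ∃ ι₁ : K →+* ℂ, f.Admissible ι₁ ∧ ∃ (V : HermSpace3 K ι₁) (σ : K →+* ℂ),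
        (Model.picardCMUniverse exists_isReal_hodgeModel_holds hodgePQ_independent_of_hodgeModel_holds
          BallQuotient.ballQuotientUniformised_holds cmAbelianVarietyRealised_holds).PeriodNV ι₁ V K f.psi σ) →
      ∀ {P B : AbelianVariety ℂ}, AbelianVariety.IsProductOf (fun B : AbelianVariety ℂ =>
        ∃ (E : Type) (_ : Field E) (_ : NumberField E) (_ : IsCMField E) (_ : E →+* (K : Type)) (Φ : CMType E)
          (ι : 𝓞 E →+* End B) (θ : E →+* Module.End ℂ (complexBetti B.X 1)),
          IsCMTypeRealisation Φ B ι θ) P →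
      AVDominatedBy B P → HodgeConjectureFor B.dim B.X) := by
  classical
  obtain ⟨A, hA⟩ := exists_cpl_of_imaginary_quadratic_subfield (F := K) σ₀ E hE hx
  by_cases hpar : Even (Module.finrank ℚ (K : Type) / 2)
  · obtain ⟨⟨𝒮, hcard, hgen⟩, -⟩ := isLeast_card_faces_hgen_of_cpl_even hA hpar σ₀
    refine ⟨𝒮, by rw [if_pos hpar, hcard], fun h P B hP hB => ?_⟩
    exact hodgeConjectureFor_of_avDominatedBy_isProductOf_of_exists_facePeriod_on K h6 (𝒮 : Set (Face K)) σ₀ hgen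
      (fun f hf => h f (Finset.mem_coe.mp hf)) hP hB
  · have hodd : Odd (Module.finrank ℚ (K : Type) / 2) := Nat.not_even_iff_odd.mp hpar
    obtain ⟨⟨𝒮, hcard, hgen⟩, -⟩ := isLeast_card_faces_hgen_of_cpl_odd hA hodd σ₀
    refine ⟨𝒮, by rw [if_neg hpar, hcard], fun h P B hP hB => ?_⟩
    exact hodgeConjectureFor_of_avDominatedBy_isProductOf_of_exists_facePeriod_on K h6 (𝒮 : Set (Face K)) σ₀ hgen
      (fun f hf => h f (Finset.mem_coe.mp hf)) hP hB

/-- **HC reading, complement form** (any complement `A` of `conjT` in `GalT K`; INT2-GEN socket BY NAME; CONDITIONAL — `HC_CM` is NOT proved).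
[cite: Shimura1998, §6.2 Theorem 3 and §6.1 Corollary of Theorem 2 (pp. 41–43)] [cite: Pohlmann1968, Thm. 1]
[cite: Milne1999LefschetzClasses, Thm. 3.2 and Cor. 4.5] [cite: MumfordAV1970, §19 Thm. 1 and p. 169] -/
theorem hodgeConjectureFor_of_cpl_of_exists_facePeriod (K : CMField) [hGal : IsGalois ℚ K] {A : Subgroup (GalT K)}
    (hA : ∀ P : GalT K, P ∈ A ↔ conjT * P ∉ A) (T₀ : CMF (GalT K) conjT) (h6 : 6 ≤ Module.finrank ℚ K) (σ₀ : (K : Type) →+* ℂ) :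
    ∃ 𝒮 : Finset (Face K), 𝒮.card + 1 + wdelta (conjT : GalT K) T₀ = Fintype.card (Block (conjT : GalT K)) ∧
      ((∀ f ∈ 𝒮, ∃ ι₁ : K →+* ℂ, f.Admissible ι₁ ∧ ∃ (V : HermSpace3 K ι₁) (σ : K →+* ℂ),
        (Model.picardCMUniverse exists_isReal_hodgeModel_holds hodgePQ_independent_of_hodgeModel_holds
          BallQuotient.ballQuotientUniformised_holds cmAbelianVarietyRealised_holds).PeriodNV ι₁ V K f.psi σ) →
      ∀ {P B : AbelianVariety ℂ}, AbelianVariety.IsProductOf (fun B : AbelianVariety ℂ =>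
        ∃ (E : Type) (_ : Field E) (_ : NumberField E) (_ : IsCMField E) (_ : E →+* (K : Type)) (Φ : CMType E)
          (ι : 𝓞 E →+* End B) (θ : E →+* Module.End ℂ (complexBetti B.X 1)),
          IsCMTypeRealisation Φ B ι θ) P →
      AVDominatedBy B P → HodgeConjectureFor B.dim B.X) := by
  obtain ⟨𝒮, hcard, hgen⟩ := exists_faces_hgen_of_cpl (F := K) hA T₀ σ₀
  refine ⟨𝒮, hcard, fun h P B hP hB => ?_⟩
  exact hodgeConjectureFor_of_avDominatedBy_isProductOf_of_exists_facePeriod_on K h6 (𝒮 : Set (Face K)) σ₀ hgen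
    (fun f hf => h f (Finset.mem_coe.mp hf)) hP hB

end Summit.HodgeConjecture.CorCM.FaceComplement

end
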